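import Summits.QuantumFields.YangMills.Theorems.BalabanUVNodesN15KingModelFullPropagatorL2SecondOrderTools
import Summits.QuantumFields.YangMills.Theorems.BalabanUVNodesN15KingModelFullPropagatorL2SecondOrderCutoff
import Summits.QuantumFields.YangMills.Theorems.BalabanUVNodesN15KingModelFullPropagatorL2Local
import Summits.QuantumFields.YangMills.Theorems.BalabanUVNodesN15KingModelFullPropagatorL2Bounds
import HarnessLib

/-!
# BalabanUVNodes ∕ N15 — THE KING-MODEL RUNG, CURVED EDITION (PART Υ-b): LETTERS FOR THE SECOND-ORDER `L²` MEMBERS OF [B9] (3.46) AT `U ≡ 1` —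
# the equation squared, the GLOBAL bound `Σ_x(N²∂_μ∂_νA₀⁻¹λ)² ≤ C²Σλ²` (every volume), the near-block localisation bookkeeping, the product rule summed,
# and the near-indicator domination of the cut-off letters, for King's full `A = 0` propagator
# (Track A, DAG node N15 = NE2; FAN-OUT v1.1 §N15 s3 «KING-MODEL RUNG … + the one-line statement of what the curved case adds»)

HONEST FRAMING.  Count-neutral operator bookkeeping (cell `pub-ymgap`, seat `pub-ymgap-dag-n15-e` g17; `--supports stmt-QuantumFields-27366 --as helper` =
K3⁸ `SpineGivenEndpointR13SepCoPHV`).  TEMPLATE LITERATURE, `A = 0`: C. King's scalar U(1)-Higgs MODEL on finite tori ([King1986] (2.13) p. 653, (4.1)–(4.5)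
p. 670), NOT Bałaban's covariant objects.  [Balaban1985BackgroundPropagators] Thm 3.1 (3.46)–(3.47) p. 398, fifth entry `‖h∇_U∇_UG′(U)λ‖` (shape).  At `U ≡ 1`,
for King's full `A = 0` propagator `A₀⁻¹` (`A₀ = N²(−Δ) + m² + a_KQ*Q`), this file supplies the LETTERS that part Υ-b′ (`…FullPropagatorL2LocalSecondOrder`)
assembles into the localised fifth entry: THE EQUATION `N²Δu = m²u + a_KQ*Qu − λ` (part Q4b `lap_inv_mulVec_eq`) squared; the GLOBAL bound by part Υ-a's
torus `H²` identity and part X's `‖A₀⁻¹‖ ≤ γ₀⁻¹` (`fullPropOps_l2_unif`); the bookkeeping that turns part Ξ-a's per-block letters decaying from the source block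
into bounds over the `≤ 5^{d+1}` blocks near the cut-off block; part Υ-a's product rule summed (backward cross terms re-indexed into forward ones); and the
domination of part Υ-a′'s cut-off letters by the near-indicator `[|b − B(x)|_∞ ≤ 2]`.  Decided in the MODEL; NOT the printed proposition; NE2⁺ is NOT PRINTED
and not proved; NOT a node discharge; nothing continuum ∕ ℝ⁴ ∕ OS ∕ mass-gap ∕ Clay.  0 `sorry`, 0 `def`, standard axioms.
* §1 `sq_lap_inv_le` (`(N²Δu)² ≤ 3(m₀⁴u² + a²(Q*Qu)² + λ²)`), `sum_sq_blockProj_le` (`‖Q*Q‖ ≤ 1`), ★ **`fullPropHessOp_l2_global`** (`Σ_x(N²∂_μ∂_νA₀⁻¹λ)² ≤ C²Σλ²`,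
  EVERY volume — the model twin of [B9]'s global (3.47)-type bound for the fifth entry);
* §2 `sum_nearBlocks_le`, `tdistT_le_one_of_two`, `sum_sq_lapOp_mul_le`;
* §3 ★ `blockBump_letters_le_near` (`χ_b² ≤ ω`, `(N²Δχ_b)² ≤ (16π⁴(d+1))²ω`, `(N(χ_b(·+e_ρ) − χ_b))² ≤ π²ω`, `ω = [|b − B(·)|_∞ ≤ 2]`).
WHAT THE CURVED CASE ADDS (one line): (3.46)₅ for `G(U)` over `Reg335` with the multiscale sites — [B9]'s random-walk expansion (N06's row), untouched.
HONEST SCOPE.  (i) `A = 0`, periodic b.c., odd `L ≥ 3` where Ξ-a is used (§1 needs only `L ≥ 2`), cubes `2L^e`, `K ≥ 1`, `0 < m² ≤ m₀²`; (ii) King's spelling,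
plain `ℓ²` sums, forward η-differences; (iii) not Bałaban's `G(U)`; not a discharge.
Locators: [Balaban1985BackgroundPropagators] Thm 3.1 (3.46)–(3.47) p. 398; [King1986] (2.13) p. 653, (4.1)–(4.5) p. 670, (4.36) p. 674; [Balaban1984PropagatorsII] (2.36) p. 229.
-/

noncomputable section

namespace Summit.QuantumFields.YangMills.BalabanUVNodes.N15KingModelRung.Curved

open Real Finset Matrix
open Literature.MathematicalPhysics.QuantumFieldTheory.Balaban1983to89.B4Sect5Proof (latticeConst latticeConst_nonneg)
open Literature.MathematicalPhysics.QuantumFieldTheory.Balaban1983to89.B4TorusKernel.MultiPeriod (circAbs)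
open Literature.MathematicalPhysics.QuantumFieldTheory.Balaban1983to89.B5Prop11Plancherel (Tor fine unitVec)
open Literature.MathematicalPhysics.QuantumFieldTheory.King1986 (aK aK_pos aK_le)
open Literature.MathematicalPhysics.QuantumFieldTheory.King1986.Torus (fineOp blockOf blockProj tdistT tdistT_nonneg tdistT_symm tdistT_self
  tdistT_triangle tdistT_sumBound tdistT_le_of_coord)
open Summit.QuantumFields.YangMills.BalabanUVNodes.N15.KingModel (fwdDiff adjDiff lapOp fwdDiff_apply lapOp_apply)
open Summit.QuantumFields.YangMills.BalabanUVNodes.N15.Gluing (bcube)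

variable {d : ℕ} (L : ℕ) [NeZero L]

/-! ## §1 The equation squared and the global second-order bound -/

omit [NeZero L] in
/-- **THE EQUATION, SQUARED**: for `u = A₀⁻¹λ` (`A₀ = N²(−Δ) + m² + a_KQ*Q`, `0 < m² ≤ m₀²`, `0 < a_K ≤ a`):
`(N²(Δu)(x))² ≤ 3·(m₀⁴·u(x)² + a²·((Q*Qu)(x))² + λ(x)²)` (part Q4b `lap_inv_mulVec_eq`). [cite: King1986, (4.1)–(4.5) p.670] -/
theorem sq_lap_inv_le (hL : 2 ≤ L) {a : ℝ} (ha : 0 < a) {K : ℕ} (hK : 1 ≤ K) (N : ℕ) [NeZero N] (M : Fin (d + 1) → ℕ) [∀ μ, NeZero (M μ)]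
    {msq m0sq : ℝ} (hmsq : 0 < msq) (hcap : msq ≤ m0sq) (lam : Tor (fine N M) → ℝ) (x : Tor (fine N M)) :
    ((N : ℝ) ^ 2 * lapOp (fine N M) ((fineOp N M (aK a L K) (((N : ℕ) : ℝ) ^ 2) msq)⁻¹ *ᵥ lam) x) ^ 2
      ≤ 3 * (m0sq ^ 2 * (((fineOp N M (aK a L K) (((N : ℕ) : ℝ) ^ 2) msq)⁻¹ *ᵥ lam) x) ^ 2
        + a ^ 2 * ((blockProj N M *ᵥ ((fineOp N M (aK a L K) (((N : ℕ) : ℝ) ^ 2) msq)⁻¹ *ᵥ lam)) x) ^ 2 + (lam x) ^ 2) := by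
  have hL1 : (1 : ℝ) < L := by exact_mod_cast (show 1 < L by omega)
  have haK0 : 0 < aK a L K := aK_pos ha hL1 hK
  have haK : aK a L K ≤ a := aK_le ha hL1 hK
  set u := (fineOp N M (aK a L K) (((N : ℕ) : ℝ) ^ 2) msq)⁻¹ *ᵥ lam with hu
  have heq := lap_inv_mulVec_eq (d := d) N M (a := aK a L K) (c := ((N : ℕ) : ℝ) ^ 2) (m2 := msq) haK0.le (by positivity) hmsq lam x
  rw [← hu] at heq
  have hlap : ((N : ℕ) : ℝ) ^ 2 * lapOp (fine N M) u x = msq * u x + aK a L K * (blockProj N M *ᵥ u) x - lam x := by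
    rw [lapOp_apply]; exact heq
  rw [hlap]
  set U := u x
  set P := (blockProj N M *ᵥ u) x
  set Λ := lam x
  have h3 : (msq * U + aK a L K * P - Λ) ^ 2 ≤ 3 * ((msq * U) ^ 2 + (aK a L K * P) ^ 2 + Λ ^ 2) := by
    nlinarith [sq_nonneg (msq * U - aK a L K * P), sq_nonneg (msq * U + Λ), sq_nonneg (aK a L K * P + Λ)]
  have hm : (msq * U) ^ 2 ≤ m0sq ^ 2 * U ^ 2 := by
    rw [mul_pow]; exact mul_le_mul_of_nonneg_right (pow_le_pow_left₀ hmsq.le hcap 2) (sq_nonneg _)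
  have hap : (aK a L K * P) ^ 2 ≤ a ^ 2 * P ^ 2 := by
    rw [mul_pow]; exact mul_le_mul_of_nonneg_right (pow_le_pow_left₀ haK0.le haK 2) (sq_nonneg _)
  linarith

/-- `Q*Q` is an `L²`-contraction on the whole torus: `Σ_x((Q*Qg)(x))² ≤ Σ_x g(x)²` (part Υ-a's block-by-block contraction, summed). [cite: King1986, (4.36) p.674] -/
theorem sum_sq_blockProj_le (N : ℕ) [NeZero N] (M : Fin (d + 1) → ℕ) [∀ μ, NeZero (M μ)] (g : Tor (fine N M) → ℝ) :
    ∑ x, ((blockProj N M *ᵥ g) x) ^ 2 ≤ ∑ x, (g x) ^ 2 := by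
  rw [sum_eq_sum_blocks N M (fun x => ((blockProj N M *ᵥ g) x) ^ 2), sum_eq_sum_blocks N M (fun x => (g x) ^ 2)]
  exact Finset.sum_le_sum fun b _ => sum_block_sq_blockProj_le N M g b

omit [NeZero L] in
/-- ★ **THE GLOBAL SECOND-ORDER BOUND** (every volume): for `L ≥ 2`, `a > 0`, `m₀² ≥ 0` there is `C > 0` with, for every `K ≥ 1`, `N = L^K`, volume `M`,
mass `0 < m² ≤ m₀²`, directions `μ, ν` and source `λ`: `Σ_x (N²·∂_μ∂_ν(A₀⁻¹λ)(x))² ≤ C²·Σ_zλ(z)²` — the torus `H²` identity, the equation squared,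
`‖Q*Q‖ ≤ 1` and part X's `‖A₀⁻¹‖ ≤ γ₀⁻¹`. [cite: Balaban1985BackgroundPropagators, Thm 3.1 (3.46)–(3.47) p.398 (fifth entry, global shape); King1986, (4.1)–(4.5) p.670] -/
theorem fullPropHessOp_l2_global (hL : 2 ≤ L) {a : ℝ} (ha : 0 < a) (m0sq : ℝ) :
    ∃ C : ℝ, 0 < C ∧ ∀ (K : ℕ), 1 ≤ K → ∀ (N : ℕ) [NeZero N], N = L ^ K →
      ∀ (M : Fin (d + 1) → ℕ) [∀ μ, NeZero (M μ)] (msq : ℝ), 0 < msq → msq ≤ m0sq → ∀ (μ ν : Fin (d + 1)) (lam : Tor (fine N M) → ℝ),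
        ∑ x, ((N : ℝ) ^ 2 * N15.KingModel.fwdDiff (fine N M) μ (N15.KingModel.fwdDiff (fine N M) ν ((fineOp N M (aK a L K) (((N : ℕ) : ℝ) ^ 2) msq)⁻¹ *ᵥ lam)) x) ^ 2
          ≤ C ^ 2 * ∑ z, lam z ^ 2 := by
  obtain ⟨γ₀, hγ₀, HX⟩ := fullPropOps_l2_unif (d := d) L hL ha
  set B : ℝ := 3 * ((m0sq ^ 2 + a ^ 2) * (γ₀⁻¹) ^ 2 + 1) with hB
  have hB0 : 0 < B := by positivity
  refine ⟨Real.sqrt B, Real.sqrt_pos.mpr hB0, ?_⟩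
  intro K hK N _ hN M _ msq hmsq hcap μ ν lam
  rw [Real.sq_sqrt hB0.le]
  set u := (fineOp N M (aK a L K) (((N : ℕ) : ℝ) ^ 2) msq)⁻¹ *ᵥ lam with hu
  have hglob := (HX K hK N hN M msq hmsq μ ν lam lam).1
  rw [← hu] at hglob
  -- `Σ u² ≤ γ₀⁻² Σ λ²`
  have hu2 : ∑ x, (u x) ^ 2 ≤ (γ₀⁻¹) ^ 2 * ∑ z, lam z ^ 2 := by
    have e1 : ∑ x, (u x) ^ 2 = u ⬝ᵥ u := by simp [dotProduct, sq]
    have e2 : ∑ z, lam z ^ 2 = lam ⬝ᵥ lam := by simp [dotProduct, sq]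
    rw [e1, e2]; exact hglob
  have hP2 : ∑ x, ((blockProj N M *ᵥ u) x) ^ 2 ≤ (γ₀⁻¹) ^ 2 * ∑ z, lam z ^ 2 := (sum_sq_blockProj_le N M u).trans hu2
  -- the `H²` identity and the equation
  calc ∑ x, ((N : ℝ) ^ 2 * N15.KingModel.fwdDiff (fine N M) μ (N15.KingModel.fwdDiff (fine N M) ν u) x) ^ 2
      = ((N : ℝ) ^ 2) ^ 2 * ∑ x, (N15.KingModel.fwdDiff (fine N M) μ (N15.KingModel.fwdDiff (fine N M) ν u) x) ^ 2 := by
        rw [Finset.mul_sum]; exact Finset.sum_congr rfl fun x _ => by ring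
    _ ≤ ((N : ℝ) ^ 2) ^ 2 * ∑ x, (lapOp (fine N M) u x) ^ 2 :=
        mul_le_mul_of_nonneg_left (sum_sq_fwdDiff_fwdDiff_le_sum_sq_lapOp (fine N M) μ ν u) (by positivity)
    _ = ∑ x, ((N : ℝ) ^ 2 * lapOp (fine N M) u x) ^ 2 := by
        rw [Finset.mul_sum]; exact Finset.sum_congr rfl fun x _ => by ring
    _ ≤ ∑ x, 3 * (m0sq ^ 2 * (u x) ^ 2 + a ^ 2 * ((blockProj N M *ᵥ u) x) ^ 2 + (lam x) ^ 2) :=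
        Finset.sum_le_sum fun x _ => sq_lap_inv_le L hL ha hK N M hmsq hcap lam x
    _ = 3 * (m0sq ^ 2 * ∑ x, (u x) ^ 2 + a ^ 2 * ∑ x, ((blockProj N M *ᵥ u) x) ^ 2 + ∑ x, (lam x) ^ 2) := by
        rw [Finset.mul_sum]
        simp only [Finset.sum_add_distrib, Finset.mul_sum, mul_add]
    _ ≤ 3 * (m0sq ^ 2 * ((γ₀⁻¹) ^ 2 * ∑ z, lam z ^ 2) + a ^ 2 * ((γ₀⁻¹) ^ 2 * ∑ z, lam z ^ 2) + ∑ x, (lam x) ^ 2) := by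
        gcongr
    _ = B * ∑ z, lam z ^ 2 := by rw [hB]; ring

/-! ## §2 Localisation bookkeeping: block sums near the cut-off block against a letter decaying from the source block -/

/-- **NEAR-BLOCK SUMS**: if every block sum of `F²` is `≤ (C·e^{−δ|b″ − b′|})²·S` (`C, δ, S ≥ 0`), then the sum of `F²` over the blocks at sup-distance `≤ 2`
from `b` is `≤ e²·Λ₁·(C·e^{2δ}·e^{−δ|b − b′|})²·S`, `Λ₁ = latticeConst (d+1) 1` (the number of such blocks is `≤ e²Σ_{b″}e^{−|b−b″|} ≤ e²Λ₁`; triangle inequality).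
[folklore] -/
theorem sum_nearBlocks_le (N : ℕ) [NeZero N] (M : Fin (d + 1) → ℕ) [∀ μ, NeZero (M μ)] (F : Tor (fine N M) → ℝ) (b b' : Tor M)
    {C δ S : ℝ} (hC : 0 ≤ C) (hδ : 0 ≤ δ) (hS : 0 ≤ S)
    (hF : ∀ b'' : Tor M, ∑ x, (if blockOf N M x = b'' then (F x) ^ 2 else 0) ≤ (C * Real.exp (-(δ * tdistT M b'' b'))) ^ 2 * S) :
    ∑ x, (if tdistT M b (blockOf N M x) ≤ 2 then (F x) ^ 2 else 0)
      ≤ Real.exp 2 * latticeConst (d + 1) 1 * (C * Real.exp (2 * δ) * Real.exp (-(δ * tdistT M b b'))) ^ 2 * S := by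
  have hsb := tdistT_sumBound M 1 one_pos b
  simp only [one_mul] at hsb
  -- block decomposition
  have hdec : ∑ x, (if tdistT M b (blockOf N M x) ≤ 2 then (F x) ^ 2 else 0)
      = ∑ b'' : Tor M, (if tdistT M b b'' ≤ 2 then (1 : ℝ) else 0) * ∑ x, (if blockOf N M x = b'' then (F x) ^ 2 else 0) := by
    rw [sum_eq_sum_blocks N M]
    refine Finset.sum_congr rfl fun b'' _ => ?_
    rw [Finset.mul_sum]
    refine Finset.sum_congr rfl fun x _ => ?_
    by_cases hx : blockOf N M x = b''
    · rw [if_pos hx, if_pos hx, hx]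
      split_ifs <;> simp
    · rw [if_neg hx, if_neg hx, mul_zero]
  rw [hdec]
  -- per block
  have hblock : ∀ b'' : Tor M, (if tdistT M b b'' ≤ 2 then (1 : ℝ) else 0) * ∑ x, (if blockOf N M x = b'' then (F x) ^ 2 else 0)
      ≤ Real.exp 2 * Real.exp (-(tdistT M b b'')) * ((C * Real.exp (2 * δ) * Real.exp (-(δ * tdistT M b b'))) ^ 2 * S) := by
    intro b''
    have hsum0 : 0 ≤ ∑ x, (if blockOf N M x = b'' then (F x) ^ 2 else 0) :=
      Finset.sum_nonneg fun x _ => by split_ifs <;> positivity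
    by_cases hnear : tdistT M b b'' ≤ 2
    · rw [if_pos hnear, one_mul]
      have hind : 1 ≤ Real.exp 2 * Real.exp (-(tdistT M b b'')) := by
        rw [← Real.exp_add]; exact Real.one_le_exp (by linarith)
      have htri : tdistT M b b' ≤ 2 + tdistT M b'' b' := (tdistT_triangle M b b'' b').trans (by linarith)
      have hexp : Real.exp (-(δ * tdistT M b'' b')) ≤ Real.exp (2 * δ) * Real.exp (-(δ * tdistT M b b')) := by
        rw [← Real.exp_add]; refine Real.exp_le_exp.mpr ?_; nlinarith
      have hsq : (C * Real.exp (-(δ * tdistT M b'' b'))) ^ 2 ≤ (C * Real.exp (2 * δ) * Real.exp (-(δ * tdistT M b b'))) ^ 2 := by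
        rw [mul_assoc C]
        exact pow_le_pow_left₀ (by positivity) (mul_le_mul_of_nonneg_left hexp hC) 2
      calc ∑ x, (if blockOf N M x = b'' then (F x) ^ 2 else 0) ≤ (C * Real.exp (-(δ * tdistT M b'' b'))) ^ 2 * S := hF b''
        _ ≤ (C * Real.exp (2 * δ) * Real.exp (-(δ * tdistT M b b'))) ^ 2 * S := mul_le_mul_of_nonneg_right hsq hS
        _ ≤ Real.exp 2 * Real.exp (-(tdistT M b b'')) * ((C * Real.exp (2 * δ) * Real.exp (-(δ * tdistT M b b'))) ^ 2 * S) :=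
            le_mul_of_one_le_left (by positivity) hind
    · rw [if_neg hnear, zero_mul]; positivity
  refine (Finset.sum_le_sum fun b'' _ => hblock b'').trans ?_
  rw [← Finset.sum_mul, ← Finset.mul_sum]
  have h0 : 0 ≤ (C * Real.exp (2 * δ) * Real.exp (-(δ * tdistT M b b'))) ^ 2 * S := by positivity
  calc Real.exp 2 * (∑ b'', Real.exp (-(tdistT M b b''))) * ((C * Real.exp (2 * δ) * Real.exp (-(δ * tdistT M b b'))) ^ 2 * S)
      ≤ Real.exp 2 * latticeConst (d + 1) 1 * ((C * Real.exp (2 * δ) * Real.exp (-(δ * tdistT M b b'))) ^ 2 * S) := by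
        gcongr
    _ = _ := by ring

/-- In the two-block volume (`M_ν = 2`) every pair of blocks is at sup-distance `≤ 1`. [folklore] -/
theorem tdistT_le_one_of_two (M : Fin (d + 1) → ℕ) [∀ μ, NeZero (M μ)] (hM : ∀ μ, M μ = 2) (b b' : Tor M) : tdistT M b b' ≤ 1 := by
  have h2 : ∀ z : ℤ, circAbs 2 z ≤ 1 := fun z => by
    unfold circAbs
    push_cast
    omega
  have h2' : ∀ (n : ℕ), n = 2 → ∀ z : ℤ, circAbs n z ≤ 1 := by rintro n rfl z; exact h2 z
  have h := tdistT_le_of_coord M b b' 1 fun μ => h2' (M μ) (hM μ) _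
  exact_mod_cast h

/-- **THE PRODUCT RULE, SQUARED AND SUMMED, with the scale factors** (`K` any torus): the backward cross terms are the forward ones read at `x − e_ρ`, so
`Σ_x(n²Δ(χu))² ≤ Σ_x[3χ²(n²Δu)² + 3u²(n²Δχ)² + 12(d+1)Σ_ρ(n(χ(x+e_ρ)−χ(x)))²(n(u(x+e_ρ)−u(x)))²]`. [folklore] -/
theorem sum_sq_lapOp_mul_le {Kt : Fin (d + 1) → ℕ} [∀ μ, NeZero (Kt μ)] (n : ℝ) (χ u : Tor Kt → ℝ) :
    ∑ x, (n ^ 2 * lapOp Kt (fun z => χ z * u z) x) ^ 2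
      ≤ ∑ x, (3 * (χ x) ^ 2 * (n ^ 2 * lapOp Kt u x) ^ 2 + 3 * (u x) ^ 2 * (n ^ 2 * lapOp Kt χ x) ^ 2
          + 12 * (d + 1) * ∑ ρ, (n * (χ (x + unitVec Kt ρ) - χ x)) ^ 2 * (n * (u (x + unitVec Kt ρ) - u x)) ^ 2) := by
  set F : Fin (d + 1) → Tor Kt → ℝ := fun ρ x => (n * (χ (x + unitVec Kt ρ) - χ x)) ^ 2 * (n * (u (x + unitVec Kt ρ) - u x)) ^ 2 with hF
  set G : Fin (d + 1) → Tor Kt → ℝ := fun ρ x => (n * (χ (x - unitVec Kt ρ) - χ x)) ^ 2 * (n * (u (x - unitVec Kt ρ) - u x)) ^ 2 with hG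
  -- the backward cross terms, re-indexed: `Σ_x G_ρ(x) = Σ_x F_ρ(x)`
  have hback : ∀ ρ : Fin (d + 1), ∑ x, G ρ x = ∑ x, F ρ x := by
    intro ρ
    rw [← sum_comp_add_torus Kt (G ρ) (unitVec Kt ρ)]
    refine Finset.sum_congr rfl fun x _ => ?_
    simp only [hF, hG, add_sub_cancel_right]
    ring
  have hpt : ∀ x, (n ^ 2 * lapOp Kt (fun z => χ z * u z) x) ^ 2
      ≤ (3 * (χ x) ^ 2 * (n ^ 2 * lapOp Kt u x) ^ 2 + 3 * (u x) ^ 2 * (n ^ 2 * lapOp Kt χ x) ^ 2)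
        + 6 * (d + 1) * ∑ ρ, F ρ x + 6 * (d + 1) * ∑ ρ, G ρ x := by
    intro x
    have h := sq_lapOp_mul_le Kt n χ u x
    rw [Finset.sum_add_distrib, mul_add] at h
    simpa only [hF, hG, add_assoc] using h
  have hsumG : ∑ x, ∑ ρ, G ρ x = ∑ x, ∑ ρ, F ρ x := by
    rw [Finset.sum_comm, Finset.sum_comm (f := fun x ρ => F ρ x)]
    exact Finset.sum_congr rfl fun ρ _ => hback ρ
  calc ∑ x, (n ^ 2 * lapOp Kt (fun z => χ z * u z) x) ^ 2
      ≤ ∑ x, ((3 * (χ x) ^ 2 * (n ^ 2 * lapOp Kt u x) ^ 2 + 3 * (u x) ^ 2 * (n ^ 2 * lapOp Kt χ x) ^ 2)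
          + 6 * (d + 1) * ∑ ρ, F ρ x + 6 * (d + 1) * ∑ ρ, G ρ x) := Finset.sum_le_sum fun x _ => hpt x
    _ = ∑ x, (3 * (χ x) ^ 2 * (n ^ 2 * lapOp Kt u x) ^ 2 + 3 * (u x) ^ 2 * (n ^ 2 * lapOp Kt χ x) ^ 2)
          + 6 * (d + 1) * ∑ x, ∑ ρ, F ρ x + 6 * (d + 1) * ∑ x, ∑ ρ, G ρ x := by
        rw [Finset.sum_add_distrib, Finset.sum_add_distrib, Finset.mul_sum, Finset.mul_sum]
    _ = ∑ x, (3 * (χ x) ^ 2 * (n ^ 2 * lapOp Kt u x) ^ 2 + 3 * (u x) ^ 2 * (n ^ 2 * lapOp Kt χ x) ^ 2)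
          + 12 * (d + 1) * ∑ x, ∑ ρ, F ρ x := by rw [hsumG]; ring
    _ = _ := by
        rw [Finset.mul_sum, ← Finset.sum_add_distrib]

/-! ## §3 The cut-off letters dominated by the near-indicator -/

/-- **THE NEAR-INDICATOR DOMINATES THE CUT-OFF LETTERS**: with `ω(x) = [|b − B(x)|_∞ ≤ 2]`, the block cut-off `χ_b` of part Υ-a′ on cubes `M_ν = Kc ≥ 6`,
`N ≥ 3`: `χ_b(x)² ≤ ω(x)`, `(N²Δχ_b(x))² ≤ (16π⁴(d+1))²ω(x)`, `(N(χ_b(x+e_ρ) − χ_b(x)))² ≤ π²ω(x)` (support + size + gradient + Laplacian letters).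
[cite: Balaban1984PropagatorsII, (2.36) p.229 (shape)] -/
theorem blockBump_letters_le_near (N : ℕ) [NeZero N] (M : Fin (d + 1) → ℕ) [∀ μ, NeZero (M μ)] {Kc : ℕ} (hM : ∀ μ, M μ = Kc)
    (hKc6 : 6 ≤ Kc) (hN3 : 3 ≤ N) (b : Tor M) (x : Tor (fine N M)) :
    (bcube Kc (fun ν (x : Tor (fine N M)) => (((x ν).val : ℕ) : ℝ) / N - (1 + 1 / (N : ℝ)) / 2) 1 (fun ν => (((b ν).val : ℕ) : ZMod Kc)) x) ^ 2 ≤ (if tdistT M b (blockOf N M x) ≤ 2 then (1 : ℝ) else 0) ∧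
    (((N : ℝ) ^ 2 * lapOp (fine N M) (bcube Kc (fun ν (x : Tor (fine N M)) => (((x ν).val : ℕ) : ℝ) / N - (1 + 1 / (N : ℝ)) / 2) 1 (fun ν => (((b ν).val : ℕ) : ZMod Kc))) x) ^ 2
        ≤ (16 * π ^ 4 * (d + 1)) ^ 2 * (if tdistT M b (blockOf N M x) ≤ 2 then (1 : ℝ) else 0)) ∧
    (∀ ρ : Fin (d + 1), ((N : ℝ) * (bcube Kc (fun ν (x : Tor (fine N M)) => (((x ν).val : ℕ) : ℝ) / N - (1 + 1 / (N : ℝ)) / 2) 1 (fun ν => (((b ν).val : ℕ) : ZMod Kc)) (x + unitVec (fine N M) ρ) - bcube Kc (fun ν (x : Tor (fine N M)) => (((x ν).val : ℕ) : ℝ) / N - (1 + 1 / (N : ℝ)) / 2) 1 (fun ν => (((b ν).val : ℕ) : ZMod Kc)) x)) ^ 2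
        ≤ π ^ 2 * (if tdistT M b (blockOf N M x) ≤ 2 then (1 : ℝ) else 0)) := by
  have hKc : 0 < Kc := by omega
  have hN : (0 : ℝ) < N := by exact_mod_cast (show 0 < N by omega)
  set χ := bcube Kc (fun ν (x : Tor (fine N M)) => (((x ν).val : ℕ) : ℝ) / N - (1 + 1 / (N : ℝ)) / 2) 1 (fun ν => (((b ν).val : ℕ) : ZMod Kc)) with hχ
  by_cases hnear : tdistT M b (blockOf N M x) ≤ 2
  · simp only [if_pos hnear, mul_one]
    refine ⟨?_, ?_, fun ρ => ?_⟩
    · have h0 := blockBump_nonneg N M Kc b x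
      have h1 := blockBump_le_one N M Kc b x
      rw [hχ]; nlinarith
    · have h := abs_lapOp_blockBump_le (N := N) (M := M) hM hKc6 b x
      have h' : |(N : ℝ) ^ 2 * lapOp (fine N M) χ x| ≤ 16 * π ^ 4 * (d + 1) := by
        rw [abs_mul, abs_of_pos (by positivity : (0 : ℝ) < (N : ℝ) ^ 2), hχ]
        calc (N : ℝ) ^ 2 * |lapOp (fine N M) (bcube Kc (fun ν (x : Tor (fine N M)) => (((x ν).val : ℕ) : ℝ) / N - (1 + 1 / (N : ℝ)) / 2) 1 (fun ν => (((b ν).val : ℕ) : ZMod Kc))) x| ≤ (N : ℝ) ^ 2 * (16 * π ^ 4 * (d + 1) / (N : ℝ) ^ 2) :=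
              mul_le_mul_of_nonneg_left h (by positivity)
          _ = 16 * π ^ 4 * (d + 1) := by field_simp
      exact sq_le_sq' (abs_le.mp h').1 (abs_le.mp h').2
    · have h := abs_blockBump_add_sub_le (N := N) (M := M) hM hKc b x ρ
      have h' : |(N : ℝ) * (χ (x + unitVec (fine N M) ρ) - χ x)| ≤ π := by
        rw [abs_mul, abs_of_pos hN, hχ]
        calc (N : ℝ) * |bcube Kc (fun ν (x : Tor (fine N M)) => (((x ν).val : ℕ) : ℝ) / N - (1 + 1 / (N : ℝ)) / 2) 1 (fun ν => (((b ν).val : ℕ) : ZMod Kc)) (x + unitVec (fine N M) ρ) - bcube Kc (fun ν (x : Tor (fine N M)) => (((x ν).val : ℕ) : ℝ) / N - (1 + 1 / (N : ℝ)) / 2) 1 (fun ν => (((b ν).val : ℕ) : ZMod Kc)) x| ≤ (N : ℝ) * (π / N) :=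
              mul_le_mul_of_nonneg_left h hN.le
          _ = π := by field_simp
      exact sq_le_sq' (abs_le.mp h').1 (abs_le.mp h').2
  · -- far from `b`: the cut-off and all its one-step shifts vanish at `x`
    simp only [if_neg hnear, mul_zero]
    have h0 : χ x = 0 := by
      by_contra hne; exact hnear (tdistT_le_two_of_blockBump_ne_zero_self hM hKc hN3 hne)
    have hp : ∀ ρ, χ (x + unitVec (fine N M) ρ) = 0 := fun ρ => by
      by_contra hne; exact hnear (tdistT_le_two_of_blockBump_add_ne_zero hM hKc hN3 ρ hne)
    have hm : ∀ ρ, χ (x - unitVec (fine N M) ρ) = 0 := fun ρ => by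
      by_contra hne; exact hnear (tdistT_le_two_of_blockBump_sub_ne_zero hM hKc hN3 ρ hne)
    have hlap0 : lapOp (fine N M) χ x = 0 := by
      rw [lapOp_apply]
      exact Finset.sum_eq_zero fun ρ _ => by rw [hp ρ, hm ρ, h0]; ring
    refine ⟨by rw [h0]; simp, by rw [hlap0]; simp, fun ρ => by rw [hp ρ, h0]; simp⟩

end Summit.QuantumFields.YangMills.BalabanUVNodes.N15KingModelRung.Curved

end
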